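import Summits.Ventures.PercRepro.RankLevelSetBiIndepAvoidSkew
import Summits.Ventures.PercRepro.RankLevelSetBiIndepContainCum

/-! # RankLevelSetBiIndepContainNorm — THE NORMALIZED CUMULATIVE (CX*) (CUM-norm): THE CONTAIN PROFILE `α^X`, DIVIDED BY THE
BINOMIALS OF `#E − 2#X`, IS SKEWED RIGHT ABOUT `(#E − 2#X − 1)/2`; IT SITS ABOVE THE CUMULATIVE (CX*) (night-1 g30; dossier §42.18)

`BiContainNormSkew M` (a `Prop`, NOT asserted): with `c = #X`, `N' = #E − 2c` and `a_j := α^X_{c+j} / C(N', j)`,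
`a_i ≤ a_j` for `i < j`, `i + j ≤ N' − 1` (written cross-multiplied: `α^X_{c+i} · C(N', j) ≤ α^X_{c+j} · C(N', i)`).
At `X = ∅` it is the normalized cumulative skew of the bi-independent profile (symmetric and unimodal after the
normalization by `C(#E, k)`); for `X` a transversal of `c` parallel pairs of `U_{r,N'} ⊕ (U_{1,2})^c` it is an
equality throughout (the normalized profile is constant) — the uniform-plus-parallel family is the extremal family of
the census (every matroid on ≤ 9 elements, every contain-set; random GF(2)/GF(3) matroids on 10–12 elements; dossier
§42.18). Since the binomials increase towards the middle (**`choose_le_choose_of_add_le`**: `C(N', i) ≤ C(N', j)` for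
`i ≤ j`, `i + j ≤ N'`), (CUM-norm) gives the cumulative (CX*) on every contain-set
(**`minorPairSkew_contain_of_normSkew`**) and, on every minor, the monotone form of the profile of `M`
(**`biIndepMono_of_forall_minor_normSkew`**). Nothing here asserts (CUM-norm); every declaration has a docstring;
imports: the cell's own modules and Mathlib only. Axioms: standard. -/

namespace PercRepro

open Set Matroid

variable {α : Type} (M : Matroid α) [M.Finite]

omit [M.Finite] in
/-- **(CUM-norm)** (a `Prop`, NOT asserted): for every `X ⊆ E` with `c = #X`, `N' = #E − 2c`, and every `i < j` with
`i + j + 1 ≤ N'`: `α^X_{c+i} · C(N', j) ≤ α^X_{c+j} · C(N', i)` — the contain profile divided by the binomials of `N'`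
is skewed right about `(N' − 1)/2`. -/
def BiContainNormSkew : Prop :=
  ∀ X ⊆ M.E, ∀ i j : ℕ, i < j → i + j + 1 ≤ M.E.ncard - 2 * X.ncard →
    biContainCount M X (X.ncard + i) * (M.E.ncard - 2 * X.ncard).choose j ≤
      biContainCount M X (X.ncard + j) * (M.E.ncard - 2 * X.ncard).choose i

omit [M.Finite] in
/-- **Binomials increase towards the middle**: `C(n, i) ≤ C(n, j)` for `i ≤ j` with `i + j ≤ n`. -/
lemma choose_le_choose_of_add_le {n i j : ℕ} (hij : i ≤ j) (h : i + j ≤ n) : n.choose i ≤ n.choose j := by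
  have chain : ∀ a s : ℕ, a + s ≤ n / 2 → n.choose a ≤ n.choose (a + s) := by
    intro a s
    induction s with
    | zero => intro _; exact le_rfl
    | succ s ih =>
      intro hs
      rw [← Nat.add_assoc]
      exact (ih (by omega)).trans (Nat.choose_le_succ_of_lt_half_left (by omega))
  rcases le_or_gt j (n / 2) with hj | hj
  · have := chain i (j - i) (by omega)
    rwa [Nat.add_sub_cancel' hij] at this
  · have hjn : j ≤ n := by omega
    rw [← Nat.choose_symm hjn]
    have := chain i (n - j - i) (by omega)
    rwa [Nat.add_sub_cancel' (by omega : i ≤ n - j)] at this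

/-- **(CUM-norm) gives the cumulative (CX*) on every contain-set**: `α^X_{c+i} ≤ α^X_{c+j}` for `i < j`,
`i + j ≤ N' − 1`, because `C(N', i) ≤ C(N', j)` there. -/
theorem minorPairSkew_contain_of_normSkew (h : BiContainNormSkew M) :
    ∀ X ⊆ M.E, MinorPairSkew M X ∅ (M.E.ncard - 2 * X.ncard - 1) := by
  intro X hX i j hij hR
  have hXE : X.ncard ≤ M.E.ncard := Set.ncard_le_ncard hX M.ground_finite
  have hi := biContainCount_eq_minorPairCount M hX (k := i + X.ncard) (by omega)
  have hj := biContainCount_eq_minorPairCount M hX (k := j + X.ncard) (by omega)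
  rw [Nat.add_sub_cancel] at hi hj
  rw [← hi, ← hj]
  have h1 := h X hX i j hij (by omega)
  have h2 : (M.E.ncard - 2 * X.ncard).choose i ≤ (M.E.ncard - 2 * X.ncard).choose j :=
    choose_le_choose_of_add_le hij.le (by omega)
  have hpos : 0 < (M.E.ncard - 2 * X.ncard).choose j := Nat.choose_pos (by omega)
  rw [Nat.add_comm X.ncard i, Nat.add_comm X.ncard j] at h1
  exact Nat.le_of_mul_le_mul_right (h1.trans (Nat.mul_le_mul_left _ h2)) hpos

/-- **(CUM-norm) on every minor gives (★★) for `M`.** -/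
theorem biIndepPerElem_of_forall_minor_normSkew
    (h : ∀ N : Matroid α, Matroid.IsMinor N M → BiContainNormSkew N) : BiIndepPerElem M := by
  refine biIndepPerElem_of_cum M fun N hN => ?_
  haveI : N.Finite := ⟨M.ground_finite.subset hN.subset⟩
  exact minorPairSkew_contain_of_normSkew N (h N hN)

/-- **(CUM-norm) on every minor gives the monotone form of the profile of `M`.** -/
theorem biIndepMono_of_forall_minor_normSkew
    (h : ∀ N : Matroid α, Matroid.IsMinor N M → BiContainNormSkew N) : BiIndepMono M :=
  biIndepMono_of_perElem M (biIndepPerElem_of_forall_minor_normSkew M h)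

end PercRepro
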